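import Summits.ResolutionOfSingularities.ResolutionOfSingularities.Theorems.MarkedTransferCampaignW46ThreefoldsPadded
import HarnessLib

/-!
# [OURS · L1 W4.6 rung (ii)] The COMPONENT-WISE (∇-centred) reduction re-derived from the 0-PADDED off-centre shape
# `OffCentreLocalPad` (Threefolds.lean v4) — the form asked for by OURS-DESK #38 (proofs)

Cell res-hironaka, LADDER-RESOLUTION rung L (D-0089), slot W4.6, rung (ii); seat res-L1-s46-pv-3 (gen 2). Host route
MarkedTransfer, host item `HypersurfaceOrderReductionDimLeThree` (stmt-16156); `--kind proof --supports` it. Companion of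
`MarkedTransferCampaignW46ThreefoldsPadded` (order plumbing, the shapes compared, the whole-∇ reduction from the MONOTONE
shape) and of `…ThreefoldsComponents` / `…ThreefoldsSingular` (the g0 component-wise reduction from `OffCentreLocal`).

HONEST FRAMING. Everything below is OURS: pure logic over the campaign shapes plus the tree's order theory and topology;
NOTHING here is a statement of H. Hironaka's manuscript (2017-03-23, [Hironaka2017]) and nothing asserts that any
statement of it holds. All shapes are HYPOTHESES; the typed `Thm16_6` enters only as a hypothesis. AI review is weaker
than expert review.

WHAT. OURS-DESK #38 (lanes A res-L1-ref-a3 / B res-L1-ref-b1, 2026-08-27T00:40–00:45Z, concordant) asked that the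
reductions be re-derived from `OffCentreLocalPad ∧ StopsMonotone` instead of `OffCentreLocal` (list equality forces
`m′ = m`). Here: the registered ∇-centred reduction — `DecreaseAlongSteps → EqualityAlongSteps → StopsMonotone →
NablaTopSing → OffCentreLocalPad → TerminatesNabla` (`terminatesNabla_of_decrease_pad`), OUR MEASURE as in
`…ThreefoldsComponents` (padded top string, number of irreducible components of `∇(E_k)`, de Jong 4.27 count), the
off-centre comparison entering only through padded encodings (`padFin_congr`); rung (ii) instances
`terminatesNablaII_of_decrease_pad` / `_of_thm16_6_pad`; the host-words form `not_divergesFromNabla_hostState_of_shapes_pad`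
(via `…ThreefoldsRegime`). HONEST NOTE (Threefolds.lean v4 / `length_eq_of_padKey_eq`): for `n ≥ 1` the padded shape still
forces equal lengths, so this file is the lanes' requested form, not a substantive weakening; the component-wise reduction
from the MONOTONE shape needs another measure and is not here.

References: Threefolds.lean v4 (p481395); p472064, p475621, p475765, p477213, p480316; shared module v3 (p468540) +
anchors v2 (p468263); [BaaderNipkow1998] §2.4 through the tree's `InvStringOrder`; A. J. de Jong, *Smoothness,
semi-stability and alterations*, 4.27 through the tree's `Resolution.componentsIn` [deJong1996]. H. Hironaka, ms.
2017-03-23, Th. 16.6 p.84, §16.3 p.87 — scope only, under adjudication, not cited as fact. [Hironaka2017]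
-/

noncomputable section

set_option linter.dupNamespace false -- mandated namespace of this single-conjunct summit

open CategoryTheory AlgebraicGeometry TopologicalSpace

namespace Summit.ResolutionOfSingularities.ResolutionOfSingularities.Theorems

namespace CampaignW46

open Literature.AlgebraicGeometry.Resolution
open Literature.AlgebraicGeometry.Hironaka2017
open Literature.AlgebraicGeometry.Hironaka2017.S02Preliminaries
open Literature.AlgebraicGeometry.Hironaka2017.Datum
open Literature.AlgebraicGeometry.Hironaka2017.S15ARSchemes
open Literature.AlgebraicGeometry.Hironaka2017.S16Proof
open Literature.AlgebraicGeometry.Hironaka2017.InvStringOrder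

universe u

variable {n : ℕ} {p : ℕ} [Fact p.Prime] {K : Type u} [Field K] [CharP K p]

/-! ## The component-wise reduction from the PADDED shape (the lanes' form) -/

section NablaPad

variable {N : Notions.{u} n} {Rd : Reading p K N} {Rg : Regime p K}
variable {A A' : AmbientDatum p K} {E : IdealExponent A.Z} {R : Resume N A E}

/-- The pointwise comparison `Step.padFin_le_of_step_sing` with `OffCentreLocal` replaced by `OffCentreLocalPad`: off
the centre the padded encodings of the strings agree (`padFin_congr`), which is all the argument uses. [folklore] -/
theorem Step.padFin_le_of_step_pad (hD : DecreaseAlongSteps N Rd Rg) (hEq : EqualityAlongSteps N Rd Rg)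
    (hM : StopsMonotone N Rd Rg) (hL : OffCentreLocalPad N Rd Rg) (hRg : Rg A E) (hRd : Rd A E R) (s : Step R A')
    {η : A.Z}
    (hT1 : ∀ ξ : A.Z, ξ ∈ Literature.AlgebraicGeometry.Hironaka2017.S02Preliminaries.closedPoints A.Z →
      ξ ∈ (R.nabla : Set A.Z) → R.invStr ξ = R.invStr η)
    (hT2 : ∀ ξ : A.Z, ξ ∈ Literature.AlgebraicGeometry.Hironaka2017.S02Preliminaries.closedPoints A.Z →
      ξ ∈ E.sing → ξ ∉ (R.nabla : Set A.Z) → InvString.LexLT (R.invStr ξ) (R.invStr η))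
    {M : ℕ} (hMm : R.m ≤ M)
    {E' : IdealExponent A'.Z} (hE' : E' = s.E') (R' : Resume N A' E') (hRd' : Rd A' E' R') {ξ' : A'.Z}
    (hξ' : ξ' ∈ Literature.AlgebraicGeometry.Hironaka2017.S02Preliminaries.closedPoints A'.Z)
    (hξs : s.π ξ' ∈ E.sing) :
    padFin M (R'.invStr ξ') ≤ padFin M (R.invStr η) ∧
      (padFin M (R'.invStr ξ') = padFin M (R.invStr η) →
        ξ' ∈ strictTransformSet s.π (s.D : Set A.Z) (R.nabla : Set A.Z)) ∧
      (s.π ξ' ∈ (R.nabla : Set A.Z) → s.π ξ' ∉ (s.D : Set A.Z) →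
        padFin M (R'.invStr ξ') = padFin M (R.invStr η)) := by
  subst hE'
  have hζ := s.apply_mem_closedPoints hξ'
  have hM' : R'.m ≤ M := (hM A E R hRg hRd A' s R' hRd').trans hMm
  have hlenη : (R.invStr η).length ≤ M := by rw [Resume.length_invStr]; exact hMm
  have hlenξ' : (R'.invStr ξ').length ≤ M := by rw [Resume.length_invStr]; exact hM'
  by_cases hDζ : s.π ξ' ∈ (s.D : Set A.Z)
  · have hin : s.π ξ' ∈ (R.nabla : Set A.Z) := s.centre.subset_nabla hDζ
    have eζ : R.invStr (s.π ξ') = R.invStr η := hT1 _ hζ hin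
    by_cases hDP : ξ' ∈ R.mti.DPrime s.π s.D
    · have h128 : Eq128 R.mti (s.π ξ') R'.mti ξ' := (hEq A E R hRg hRd A' s R' hRd') ξ' hξ' hDP.1
      have hm' : R'.m ≤ R.m := hM A E R hRg hRd A' s R' hRd'
      have htake : R'.invStr ξ' = (R.invStr η).take R'.m := by
        rw [← eζ]
        change R'.mti.invStr R'.m ξ' = (R.mti.invStr R.m (s.π ξ')).take R'.m
        rw [invStr_eq_take R'.mti hm' ξ']
        exact congrArg (fun L => List.take R'.m L) h128
      have hle : padFin M (R'.invStr ξ') ≤ padFin M (R.invStr η) := by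
        rw [htake]
        by_contra hlt
        rw [not_le] at hlt
        have hlen2 : ((R.invStr η).take R'.m).length ≤ M :=
          (List.length_take_le' _ _).trans hlenη
        exact not_lexLT_take (R.invStr η) R'.m ((lexLT_iff_padFin_lt hlenη hlen2).mpr hlt)
      exact ⟨hle, fun _ => hDP.1, fun _ hnot => absurd hDζ hnot⟩
    · have h127 : Eq127 R.mti (s.π ξ') R'.mti ξ' := (hD A E R hRg hRd A' s R' hRd').1 ξ' hξ' hDζ hDP
      change InvString.LexLT (R'.invStr ξ') (R.invStr (s.π ξ')) at h127
      rw [eζ] at h127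
      have hlt : padFin M (R'.invStr ξ') < padFin M (R.invStr η) := (lexLT_iff_padFin_lt hlenξ' hlenη).mp h127
      exact ⟨hlt.le, fun heq => absurd heq hlt.ne, fun _ hnot => absurd hDζ hnot⟩
  · -- off the centre: the padded encodings agree
    have e : padFin M (R'.invStr ξ') = padFin M (R.invStr (s.π ξ')) :=
      padFin_congr M (hL A E R hRg hRd A' s R' hRd' ξ' hξ' hDζ)
    have hlenζ : (R.invStr (s.π ξ')).length ≤ M := by rw [Resume.length_invStr]; exact hMm
    by_cases hin : s.π ξ' ∈ (R.nabla : Set A.Z)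
    · have eζ : R.invStr (s.π ξ') = R.invStr η := hT1 _ hζ hin
      have heq : padFin M (R'.invStr ξ') = padFin M (R.invStr η) := by rw [e, eζ]
      refine ⟨heq.le, fun _ => ?_, fun _ _ => heq⟩
      exact strictTransformSet.preimage_diff_subset s.π _ _ ⟨hin, hDζ⟩
    · have hlt' : padFin M (R.invStr (s.π ξ')) < padFin M (R.invStr η) :=
        (lexLT_iff_padFin_lt hlenζ hlenη).mp (hT2 _ hζ hξs hin)
      rw [← e] at hlt'
      exact ⟨hlt'.le, fun heq => absurd heq hlt'.ne, fun hin' _ => absurd hin' hin⟩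

/-- `Step.nabla_eq_strictTransformSet_of_padFin_eq_sing` with `OffCentreLocalPad`: if the padded top strings agree
across a step then `∇(E′)` is the strict transform of `∇(E)` as a set (Jacobson argument unchanged). [folklore] -/
theorem Step.nabla_eq_strictTransformSet_of_padFin_eq_pad (hD : DecreaseAlongSteps N Rd Rg)
    (hEq : EqualityAlongSteps N Rd Rg) (hM : StopsMonotone N Rd Rg) (hL : OffCentreLocalPad N Rd Rg) (hRg : Rg A E)
    (hRd : Rd A E R) (s : Step R A') {η : A.Z}
    (hT1 : ∀ ξ : A.Z, ξ ∈ Literature.AlgebraicGeometry.Hironaka2017.S02Preliminaries.closedPoints A.Z →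
      ξ ∈ (R.nabla : Set A.Z) → R.invStr ξ = R.invStr η)
    (hT2 : ∀ ξ : A.Z, ξ ∈ Literature.AlgebraicGeometry.Hironaka2017.S02Preliminaries.closedPoints A.Z →
      ξ ∈ E.sing → ξ ∉ (R.nabla : Set A.Z) → InvString.LexLT (R.invStr ξ) (R.invStr η))
    {M : ℕ} (hMm : R.m ≤ M)
    {E' : IdealExponent A'.Z} (hE' : E' = s.E') (R' : Resume N A' E') (hRd' : Rd A' E' R') {η' : A'.Z}
    (hT1' : ∀ ξ' : A'.Z, ξ' ∈ Literature.AlgebraicGeometry.Hironaka2017.S02Preliminaries.closedPoints A'.Z →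
      ξ' ∈ (R'.nabla : Set A'.Z) → R'.invStr ξ' = R'.invStr η')
    (hT2' : ∀ ξ' : A'.Z, ξ' ∈ Literature.AlgebraicGeometry.Hironaka2017.S02Preliminaries.closedPoints A'.Z →
      ξ' ∈ E'.sing → ξ' ∉ (R'.nabla : Set A'.Z) → InvString.LexLT (R'.invStr ξ') (R'.invStr η'))
    (heq : padFin M (R'.invStr η') = padFin M (R.invStr η)) :
    (R'.nabla : Set A'.Z) = strictTransformSet s.π (s.D : Set A.Z) (R.nabla : Set A.Z) := by
  subst hE'
  haveI := A'.smooth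
  haveI : JacobsonSpace A'.Z := LocallyOfFiniteType.jacobsonSpace A'.hom
  have hM' : R'.m ≤ M := (hM A E R hRg hRd A' s R' hRd').trans hMm
  have hP := fun (ξ' : A'.Z)
      (hξ' : ξ' ∈ Literature.AlgebraicGeometry.Hironaka2017.S02Preliminaries.closedPoints A'.Z)
      (hξs : s.π ξ' ∈ E.sing) =>
    Step.padFin_le_of_step_pad hD hEq hM hL hRg hRd s hT1 hT2 hMm rfl R' hRd' hξ' hξs
  have h1 : ∀ ξ' : A'.Z, ξ' ∈ Literature.AlgebraicGeometry.Hironaka2017.S02Preliminaries.closedPoints A'.Z →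
      ξ' ∈ (R'.nabla : Set A'.Z) → ξ' ∈ strictTransformSet s.π (s.D : Set A.Z) (R.nabla : Set A.Z) := by
    intro ξ' hc hn
    refine (hP ξ' hc (s.apply_mem_sing (R'.nabla_subset_sing hn))).2.1 ?_
    rw [hT1' ξ' hc hn]
    exact heq
  have h2 : ∀ ξ' : A'.Z, ξ' ∈ Literature.AlgebraicGeometry.Hironaka2017.S02Preliminaries.closedPoints A'.Z →
      s.π ξ' ∈ (R.nabla : Set A.Z) → s.π ξ' ∉ (s.D : Set A.Z) → ξ' ∈ (R'.nabla : Set A'.Z) := by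
    intro ξ' hc hin hnD
    have hsing : s.π ξ' ∈ E.sing := R.nabla_subset_sing hin
    by_contra hout
    have hlt := hT2' ξ' hc (s.mem_sing_of_apply_mem_sing hsing hnD) hout
    have heq' := (hP ξ' hc hsing).2.2 hin hnD
    have hlenξ : (R'.invStr ξ').length ≤ M := by rw [Resume.length_invStr]; exact hM'
    have hlenη' : (R'.invStr η').length ≤ M := by rw [Resume.length_invStr]; exact hM'
    have hlt2 := (lexLT_iff_padFin_lt hlenξ hlenη').mp hlt
    rw [heq', heq] at hlt2
    exact lt_irrefl _ hlt2
  apply Set.Subset.antisymm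
  · have hcl : closure ((R'.nabla : Set A'.Z) ∩ _root_.closedPoints A'.Z) = (R'.nabla : Set A'.Z) :=
      closure_inter_closedPoints R'.nabla.isClosed
    rw [← hcl]
    exact closure_minimal (fun x hx => h1 x hx.2 hx.1) (strictTransformSet.isClosed _ _ _)
  · refine closure_minimal ?_ R'.nabla.isClosed
    intro x hx
    by_contra hxn
    have hdiff : IsLocallyClosed ((R.nabla : Set A.Z) \ (s.D : Set A.Z)) := by
      rw [Set.sdiff_eq]
      exact R.nabla.isClosed.isLocallyClosed.inter s.D.isClosed.isOpen_compl.isLocallyClosed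
    have hlc : IsLocallyClosed (s.π ⁻¹' ((R.nabla : Set A.Z) \ (s.D : Set A.Z)) ∩ (R'.nabla : Set A'.Z)ᶜ) :=
      (hdiff.preimage s.π.continuous).inter R'.nabla.isClosed.isOpen_compl.isLocallyClosed
    obtain ⟨y, ⟨hy1, hy2⟩, hyc⟩ :=
      nonempty_inter_closedPoints (Z := s.π ⁻¹' ((R.nabla : Set A.Z) \ (s.D : Set A.Z)) ∩ (R'.nabla : Set A'.Z)ᶜ)
        ⟨x, ⟨hx, hxn⟩⟩ hlc
    exact hy2 (h2 y hyc hy1.1 hy1.2)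

/-- **COMPONENT-WISE REDUCTION FROM THE PADDED SHAPE (general regime)** — the form asked for by OURS-DESK #38:
`DecreaseAlongSteps → EqualityAlongSteps → StopsMonotone → NablaTopSing → OffCentreLocalPad → TerminatesNabla`. OUR
MEASURE as in `…ThreefoldsComponents` (padded top string, number of irreducible components of `∇(E_k)`); the off-centre
comparison enters only through padded encodings. [folklore] -/
theorem terminatesNabla_of_decrease_pad (hD : DecreaseAlongSteps N Rd Rg) (hEq : EqualityAlongSteps N Rd Rg)
    (hM : StopsMonotone N Rd Rg) (hT : NablaTopSing N Rd Rg) (hL : OffCentreLocalPad N Rd Rg) :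
    TerminatesNabla N Rd Rg := by
  intro r hRg
  choose η hηn hηc hT1 hT2 using fun k => hT (r.A k) (r.E k) (r.R k) (hRg k) (r.reads k)
  have hmstep : ∀ k, (r.R (k + 1)).m ≤ (r.R k).m := fun k =>
    Step.stops_le hM (hRg k) (r.reads k) (r.step k).toStep (r.E_succ k) (r.R (k + 1)) (r.reads (k + 1))
  have hm : ∀ k, (r.R k).m ≤ (r.R 0).m := by
    intro k
    induction k with
    | zero => exact le_rfl
    | succ k ih => exact (hmstep k).trans ih
  have hηs : ∀ k, (r.step k).toStep.π (η (k + 1)) ∈ (r.E k).sing := by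
    intro k
    have h1 : η (k + 1) ∈ (r.E (k + 1)).sing := (r.R (k + 1)).nabla_subset_sing (hηn (k + 1))
    rw [r.E_succ k] at h1
    exact (r.step k).toStep.apply_mem_sing h1
  have hstep : ∀ k,
      padFin (r.R 0).m ((r.R (k + 1)).invStr (η (k + 1))) ≤ padFin (r.R 0).m ((r.R k).invStr (η k)) ∧
        (padFin (r.R 0).m ((r.R (k + 1)).invStr (η (k + 1))) = padFin (r.R 0).m ((r.R k).invStr (η k)) →
          (componentsIn ((r.R (k + 1)).nabla : Set (r.A (k + 1)).Z)).ncard <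
            (componentsIn ((r.R k).nabla : Set (r.A k).Z)).ncard) := by
    intro k
    refine ⟨(Step.padFin_le_of_step_pad hD hEq hM hL (hRg k) (r.reads k) (r.step k).toStep (hT1 k) (hT2 k)
      (hm k) (r.E_succ k) (r.R (k + 1)) (r.reads (k + 1)) (hηc (k + 1)) (hηs k)).1, fun heq => ?_⟩
    have hN := Step.nabla_eq_strictTransformSet_of_padFin_eq_pad hD hEq hM hL (hRg k) (r.reads k)
      (r.step k).toStep (hT1 k) (hT2 k) (hm k) (r.E_succ k) (r.R (k + 1)) (r.reads (k + 1)) (hT1 (k + 1))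
      (hT2 (k + 1)) heq
    exact Step.ncard_componentsIn_lt (r.step k).toStep (r.step k).component (r.R (k + 1)) hN
  exact no_stalling_descent (fun k => padFin (r.R 0).m ((r.R k).invStr (η k)))
    (fun k => (componentsIn ((r.R k).nabla : Set (r.A k).Z)).ncard) (fun k => (hstep k).1) fun k => (hstep k).2

/-- The padded component-wise reduction with the one-step shapes from the typed candidate `Thm16_6` (a HYPOTHESIS, via
the anchors): `Thm16_6 → StopsMonotone → NablaTopSing → OffCentreLocalPad → TerminatesNabla`. [folklore] -/
theorem terminatesNabla_of_thm16_6_pad [PerfectField K]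
    {pPosiEmptyAt : ∀ {W : Scheme.{u}}, IdealExponent W → W → Prop}
    (h : Thm16_6 (p := p) (K := K) n (primeR N Rd) pPosiEmptyAt) (hM : StopsMonotone N Rd Rg)
    (hT : NablaTopSing N Rd Rg) (hL : OffCentreLocalPad N Rd Rg) : TerminatesNabla N Rd Rg :=
  terminatesNabla_of_decrease_pad (decreaseAlongSteps_of_thm16_6 N Rd h Rg) (equalityAlongSteps_of_thm16_6 N Rd h Rg)
    hM hT hL

end NablaPad

/-! ## Rung (ii): padded forms, and the host-words form -/

section RungII

variable (N : Notions.{u} n) (Rd : Reading p K N)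

/-- RUNG (ii), ∇-centred form (registered shape), PADDED off-centre shape — the repaired form of OURS-DESK #38:
`DecreaseII → EqualityII → StopsMonotoneII → NablaTopSingII → OffCentreLocalPadII → TerminatesNablaII`. [folklore] -/
theorem terminatesNablaII_of_decrease_pad (hD : DecreaseII N Rd) (hEq : EqualityII N Rd) (hM : StopsMonotoneII N Rd)
    (hT : NablaTopSingII N Rd) (hL : OffCentreLocalPadII N Rd) : TerminatesNablaII N Rd :=
  terminatesNabla_of_decrease_pad hD hEq hM hT hL

/-- RUNG (ii), ∇-centred, padded, with the typed candidate `Thm16_6` AS A HYPOTHESIS: `Thm16_6 → StopsMonotoneII →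
NablaTopSingII → OffCentreLocalPadII → TerminatesNablaII`. [folklore] -/
theorem terminatesNablaII_of_thm16_6_pad [PerfectField K]
    {pPosiEmptyAt : ∀ {W : Scheme.{u}}, IdealExponent W → W → Prop}
    (h : Thm16_6 (p := p) (K := K) n (primeR N Rd) pPosiEmptyAt) (hM : StopsMonotoneII N Rd)
    (hT : NablaTopSingII N Rd) (hL : OffCentreLocalPadII N Rd) : TerminatesNablaII N Rd :=
  terminatesNabla_of_thm16_6_pad h hM hT hL

end RungII

section Host

variable {k : Type u} [Field k] [CharP k p] {N : Notions.{u} n} {Rd : Reading p k N}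

/-- **RUNG (ii) IN THE WORDS OF THE HOST ITEM, PADDED SHAPES**: `DecreaseII ∧ EqualityII ∧ StopsMonotoneII ∧
NablaTopSingII ∧ OffCentreLocalPadII` for the named `N`, `Rd` imply that from every input `(k, X, I, m)` of stmt-16156 (k
perfect of characteristic `p`, `X` integral regular locally of finite type quasi-compact over `k` of Krull dimension
`≤ 3`, `I` effective Cartier, `m`) the ∇-centred typed procedure admits no infinite run (`…ThreefoldsRegime`,
`not_divergesFromNabla_hostState`). All shapes are HYPOTHESES; 16156's conclusion is neither used nor derived. [folklore] -/
theorem not_divergesFromNabla_hostState_of_shapes_pad [PerfectField k] (hD : DecreaseII N Rd) (hEq : EqualityII N Rd)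
    (hM : StopsMonotoneII N Rd) (hT : NablaTopSingII N Rd) (hL : OffCentreLocalPadII N Rd) (X : Scheme.{u})
    (s : X ⟶ Spec (.of k)) [LocallyOfFiniteType s] [QuasiCompact s] [IsIntegral X] (hreg : Scheme.IsRegular X)
    (hdim : topologicalKrullDim X ≤ 3) (I : X.IdealSheafData) (hIc : IsEffectiveCartier I) (m : ℕ) (Rg : Regime p k) :
    ¬ DivergesFromNabla N Rd Rg
        (⟨X, s, inferInstance, smooth_of_isRegular_of_perfectField s hreg, inferInstance⟩ : AmbientDatum p k) ⟨I, m⟩ :=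
  not_divergesFromNabla_hostState (terminatesNablaII_of_decrease_pad N Rd hD hEq hM hT hL) X s hreg hdim I hIc m Rg

end Host

end CampaignW46

end Summit.ResolutionOfSingularities.ResolutionOfSingularities.Theorems

end
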